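import Mathlib
import Summits.ResolutionOfSingularities.ResolutionOfSingularities.Theorems.PAlterationPicoverLocalModelWoundExit
import Literature.AlgebraicGeometry.Resolution.RegularLocalRingsNormal
import Literature.AlgebraicGeometry.Resolution.AdicCompletionRegular
import HarnessLib

/-!
# Crux `Picover` (stmt-ResolutionOfSingularities-0554), line `degree-p-tower`:
# the residue field does not grow at a singular point of a degree-`p` purely inseparable cover

Registered helper `residue_bijective_of_not_isRegularRing`. Setting: `R` a regular local ring of
characteristic `p` (the stalk `𝒪_{W,w}` of the regular base), `S` the stalk over `w` of the
normalised purely inseparable cover — a normal local domain, finite over `R` of generic rank `p`,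
with `S^p ⊆ R`. Claim: if `S` is NOT regular then `κ(R) → κ(S)` is bijective.

Proof (wound exit + normality). Injectivity is automatic (a ring map out of a field). If the
residue map were not surjective, pick `σ = s̄ ∈ κ(S)` outside its image and write `s ^ p = r ∈ R`.
Then `r` is *wound* (`r - c^p ∉ 𝔪_R` for all `c`: otherwise `(s - c)^p ∈ 𝔪_S`, so `s̄ = c̄`), hence
`A := R[T]/(T^p - r)` is a regular local ring (`isRegularLocalRing_adjoinRoot_of_wound`), so a
normal domain, free of rank `p` over `R`. The map `φ : A → S`, `T ↦ s`, is injective (a nonzero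
kernel `𝔨 ∋ a` contains `aA ≅ A`, so `A/𝔨 ↪ S` would be `R`-torsion, killing `1`) and has
`R`-torsion cokernel (rank count `p = p`), so `Frac A = Frac S`; as `S` is integral over `R ⊆ A`
and `A` is integrally closed, `φ` is onto. Thus `S ≅ A` is regular local, hence a regular ring —
contradiction. No statement item is restated.
-/

set_option linter.dupNamespace false -- mandated namespace of this single-conjunct summit

universe u

namespace Summit.ResolutionOfSingularities.ResolutionOfSingularities.Theorems.Picover.ResidueAtSingularPoint

open Polynomial IsLocalRing
open Literature.AlgebraicGeometry.Resolution
open Summit.ResolutionOfSingularities.ResolutionOfSingularities.Theorems.PicoverLocalModel.WoundExit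

/-- A cardinal `a` with `a + n = n` for a natural number `n` vanishes. [folklore] -/
private theorem cardinal_eq_zero_of_add_nat_eq {a : Cardinal} {n : ℕ} (h : a + n = n) : a = 0 :=
  Cardinal.eq_of_add_eq_add_right (by rw [zero_add]; exact h) (Cardinal.natCast_lt_aleph0)

/-- **Injectivity by rank count.** An `R`-algebra map out of a domain `A` of finite rank `n` over
the domain `R` into an `R`-algebra `S` with `R → S` injective is injective: a nonzero kernel `𝔨 ∋ a`
contains `a • A ≅ A`, so `rank 𝔨 = rank A` and `A/𝔨 ↪ S` is `R`-torsion — but it contains `1`.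
[folklore] -/
private theorem algHom_injective_of_rank_eq {R A S : Type u} [CommRing R] [IsDomain R]
    [CommRing A] [IsDomain A] [Algebra R A] [CommRing S] [Algebra R S] [FaithfulSMul R S]
    {n : ℕ} (hA : Module.rank R A = n) (φ : A →ₐ[R] S) : Function.Injective φ := by
  rw [injective_iff_map_eq_zero]
  intro a ha
  by_contra ha0
  set K₀ : Submodule R A := LinearMap.ker φ.toLinearMap with hK₀
  have hle : LinearMap.range (LinearMap.mulLeft R a) ≤ K₀ := by
    rintro _ ⟨b, rfl⟩
    simp only [hK₀, LinearMap.mem_ker, AlgHom.toLinearMap_apply, LinearMap.mulLeft_apply, map_mul,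
      ha, zero_mul]
  have hinj : Function.Injective (LinearMap.mulLeft R a) := mul_right_injective₀ ha0
  have h1 : Module.rank R K₀ = n := by
    apply le_antisymm
    · exact hA ▸ Submodule.rank_le K₀
    · rw [← hA, ← rank_range_of_injective _ hinj]
      exact Submodule.rank_mono hle
  have h2 := rank_quotient_add_rank_of_isDomain K₀
  rw [h1, hA] at h2
  have h3 : Module.IsTorsion R (A ⧸ K₀) :=
    rank_eq_zero_iff_isTorsion.mp (cardinal_eq_zero_of_add_nat_eq h2)
  obtain ⟨d, hd⟩ := @h3 (Submodule.Quotient.mk 1)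
  rw [Submonoid.smul_def, ← Submodule.Quotient.mk_smul, Submodule.Quotient.mk_eq_zero, hK₀,
    LinearMap.mem_ker, AlgHom.toLinearMap_apply, map_smul, map_one, Algebra.smul_def, mul_one] at hd
  exact nonZeroDivisors.ne_zero d.2
    (FaithfulSMul.algebraMap_injective R S (by rw [hd, map_zero]))

/-- **Torsion cokernel by rank count.** If `φ : A →ₐ[R] S` is injective and `A`, `S` have the
same finite rank `n` over the domain `R`, then `S/φ(A)` is `R`-torsion: every `x : S` has a
multiple `d • x ∈ φ(A)` with `d ≠ 0`. [folklore] -/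
private theorem exists_smul_mem_range_of_rank_eq {R A S : Type u} [CommRing R] [IsDomain R]
    [CommRing A] [Algebra R A] [CommRing S] [Algebra R S]
    {n : ℕ} (hA : Module.rank R A = n) (hS : Module.rank R S = n) (φ : A →ₐ[R] S)
    (hφ : Function.Injective φ) (x : S) :
    ∃ d : R, d ≠ 0 ∧ ∃ a : A, φ a = algebraMap R S d * x := by
  set N : Submodule R S := LinearMap.range φ.toLinearMap with hN
  have h1 : Module.rank R N = n := by rw [hN, rank_range_of_injective _ hφ, hA]
  have h2 := rank_quotient_add_rank_of_isDomain N
  rw [h1, hS] at h2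
  have h3 : Module.IsTorsion R (S ⧸ N) :=
    rank_eq_zero_iff_isTorsion.mp (cardinal_eq_zero_of_add_nat_eq h2)
  obtain ⟨d, hd⟩ := @h3 (Submodule.Quotient.mk x)
  rw [Submonoid.smul_def, ← Submodule.Quotient.mk_smul, Submodule.Quotient.mk_eq_zero, hN,
    LinearMap.mem_range] at hd
  obtain ⟨a, ha⟩ := hd
  refine ⟨d, nonZeroDivisors.ne_zero d.2, a, ?_⟩
  rw [AlgHom.toLinearMap_apply] at ha
  rw [ha, Algebra.smul_def]

/-- **Surjectivity by normality.** Let `φ : A →ₐ[R] S` be an injective map of domains whose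
cokernel is `R`-torsion, with `S` integral over `R` and `A` integrally closed. Then `φ` is
surjective: `Frac S` is a fraction field of `A`, and every element of `S`, being integral over
`A`, lies in `A`. [folklore] -/
private theorem algHom_surjective_of_isIntegrallyClosed {R A S : Type u} [CommRing R] [IsDomain R]
    [CommRing A] [IsDomain A] [Algebra R A] [IsIntegrallyClosed A] [CommRing S] [IsDomain S]
    [Algebra R S] [Algebra.IsIntegral R S] [FaithfulSMul R S] (φ : A →ₐ[R] S)
    (hφ : Function.Injective φ)
    (htors : ∀ x : S, ∃ d : R, d ≠ 0 ∧ ∃ a : A, φ a = algebraMap R S d * x) :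
    Function.Surjective φ := by
  intro x
  let L := FractionRing S
  letI : Algebra A L := ((algebraMap S L).comp (φ : A →+* S)).toAlgebra
  have halg : ∀ a : A, algebraMap A L a = algebraMap S L (φ a) := fun a => rfl
  haveI : FaithfulSMul A L := (faithfulSMul_iff_algebraMap_injective A L).mpr
    ((IsFractionRing.injective S L).comp hφ)
  haveI : IsFractionRing A L := by
    refine IsFractionRing.of_field A L fun z => ?_
    obtain ⟨a, b, -, rfl⟩ := IsFractionRing.div_surjective (A := S) z
    obtain ⟨d₁, hd₁, a₁, ha₁⟩ := htors a
    obtain ⟨d₂, hd₂, b₁, hb₁⟩ := htors b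
    refine ⟨algebraMap R A d₂ * a₁, algebraMap R A d₁ * b₁, ?_⟩
    have hc : algebraMap S L (algebraMap R S (d₂ * d₁)) ≠ 0 :=
      (map_ne_zero_iff _ (IsFractionRing.injective S L)).mpr
        ((map_ne_zero_iff _ (FaithfulSMul.algebraMap_injective R S)).mpr (mul_ne_zero hd₂ hd₁))
    rw [halg, halg, map_mul φ, map_mul φ, AlgHom.commutes, AlgHom.commutes, ha₁, hb₁, ← mul_assoc,
      ← mul_assoc, ← map_mul (algebraMap R S), ← map_mul (algebraMap R S), mul_comm d₁ d₂,
      map_mul (algebraMap S L), map_mul (algebraMap S L), mul_div_mul_left _ _ hc]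
  have hint : IsIntegral A (algebraMap S L x) := by
    obtain ⟨q, hq, hqx⟩ := Algebra.IsIntegral.isIntegral (R := R) x
    refine ⟨q.map (algebraMap R A), hq.map _, ?_⟩
    have hcomp : (algebraMap A L).comp (algebraMap R A) = (algebraMap S L).comp (algebraMap R S) := by
      ext r
      rw [RingHom.comp_apply, RingHom.comp_apply, halg, AlgHom.commutes]
    rw [eval₂_map, hcomp, ← hom_eval₂, hqx, map_zero]
  obtain ⟨y, hy⟩ := IsIntegrallyClosed.algebraMap_eq_of_integral hint
  exact ⟨y, IsFractionRing.injective S L (by rw [← halg, hy])⟩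

/-- **At a singular point of a degree-`p` purely inseparable cover the residue field does not
grow.** Let `R` be a regular local ring of characteristic `p`, `S` a normal local domain, finite
over `R` of generic rank `p` along an injective local map with `S^p ⊆ R`. If `S` is not regular,
then `κ(R) → κ(S)` is bijective. (If some `s̄ ∈ κ(S)` were new, `s^p = r` would be wound,
`R[T]/(T^p - r)` regular local and normal of rank `p`, and `T ↦ s` an isomorphism onto `S`.)
[folklore] -/
theorem residue_bijective_of_not_isRegularRing : ∀ {p : ℕ} [Fact p.Prime] {R : Type u} [CommRing R] [IsRegularLocalRing R] [CharP R p] {S : Type u} [CommRing S] [IsLocalRing S] [NoZeroDivisors S] [Algebra R S] [Module.Finite R S] [FaithfulSMul R S] [IsIntegrallyClosed S] [IsLocalHom (algebraMap R S)], Module.finrank R S = p → (∀ s : S, s ^ p ∈ (algebraMap R S).range) → ¬ IsRegularRing S → Function.Bijective (IsLocalRing.ResidueField.map (algebraMap R S)) := by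
  intro p hp R _ _ _ S _ _ _ _ _ _ _ _ hrank hpow hnreg
  have hp' : p.Prime := hp.out
  haveI : IsDomain R := isDomain_of_isRegularLocalRing R
  haveI : IsDomain S := NoZeroDivisors.to_isDomain S
  refine ⟨(IsLocalRing.ResidueField.map (algebraMap R S)).injective, ?_⟩
  by_contra hsurj
  simp only [Function.Surjective, not_forall, not_exists] at hsurj
  obtain ⟨σ, hσ⟩ := hsurj
  obtain ⟨s, rfl⟩ := IsLocalRing.residue_surjective σ
  obtain ⟨r, hr⟩ := RingHom.mem_range.mp (hpow s)
  -- `r` is wound: its residue is not a `p`-th power in `κ(R)`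
  have hwound : ∀ c : R, r - c ^ p ∉ maximalIdeal R := by
    intro c hc
    apply hσ (residue R c)
    rw [ResidueField.map_residue]
    haveI : CharP S p := charP_of_injective_algebraMap (FaithfulSMul.algebraMap_injective R S) p
    have h1 : (s - algebraMap R S c) ^ p ∈ maximalIdeal S := by
      rw [sub_pow_char, ← map_pow, ← hr, ← map_sub]
      exact map_nonunit (algebraMap R S) _ hc
    have h2 : s - algebraMap R S c ∈ maximalIdeal S :=
      (inferInstance : (maximalIdeal S).IsPrime).mem_of_pow_mem p h1
    rw [eq_comm, ← sub_eq_zero, ← map_sub, residue_eq_zero_iff]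
    exact h2
  -- the wound cover `A = R[T]/(T^p - r)` is regular local, a normal domain, free of rank `p`
  set f : R[X] := X ^ p - C r with hf_def
  have hf : f.Monic := monic_X_pow_sub_C r hp'.ne_zero
  haveI : IsRegularLocalRing (AdjoinRoot f) := isRegularLocalRing_adjoinRoot_of_wound p hp' r hwound
  haveI : IsDomain (AdjoinRoot f) := isDomain_of_isRegularLocalRing _
  haveI : IsIntegrallyClosed (AdjoinRoot f) := isIntegrallyClosed_of_isRegularLocalRing _
  haveI : Module.Finite R (AdjoinRoot f) := hf.finite_adjoinRoot
  have hArank : Module.rank R (AdjoinRoot f) = p := by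
    rw [← Module.finrank_eq_rank, (AdjoinRoot.powerBasis' hf).finrank, AdjoinRoot.powerBasis'_dim,
      hf_def, natDegree_X_pow_sub_C]
  have hSrank : Module.rank R S = p := by rw [← Module.finrank_eq_rank, hrank]
  -- `φ : A → S`, `T ↦ s`, is an isomorphism
  have hfs : f.eval₂ (↑(Algebra.ofId R S) : R →+* S) s = 0 := by
    rw [hf_def, eval₂_sub, eval₂_X_pow, eval₂_C, AlgHom.coe_toRingHom, Algebra.ofId_apply, hr,
      sub_self]
  let φ : AdjoinRoot f →ₐ[R] S := AdjoinRoot.liftAlgHom f (Algebra.ofId R S) s hfs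
  have hφinj : Function.Injective φ := algHom_injective_of_rank_eq hArank φ
  haveI : Algebra.IsIntegral R S := inferInstance
  have hφsurj : Function.Surjective φ := algHom_surjective_of_isIntegrallyClosed φ hφinj
    (exists_smul_mem_range_of_rank_eq hArank hSrank φ hφinj)
  haveI : IsRegularLocalRing S :=
    IsRegularLocalRing.of_ringEquiv (RingEquiv.ofBijective φ ⟨hφinj, hφsurj⟩)
  exact hnreg (isRegularRing_of_isRegularLocalRing S)

end Summit.ResolutionOfSingularities.ResolutionOfSingularities.Theorems.Picover.ResidueAtSingularPoint
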